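import Summits.BirchSwinnertonDyer.BirchSwinnertonDyer.Theorems.KimAtThreeFineKatoKPortJunctionLogTower
import HarnessLib

/-!
# K-PORT junction (J4e): clause (e) of hLog₀ for kport's log-lattices FROM its point form — the E-side of
# `hDualTame` / `hDualWild` as two ready-made reductions (tame `Λ₀ʷ`, wild `ι(Λ₀ᵘ)`), for ANY multiplier map
# (cell `bsd-addord`, seat w2-kport gen 3; `--supports stmt-BirchSwinnertonDyer-19560`, helper)

HONEST FRAMING. Route W2 (`route-BirchSwinnertonDyer-KimAtThreeKolyvagin`), crux 19560
`KatoKuriharaPortThreeShared`, registered line `perFactorKato` (stub hKloc, kim3 LEAD), part hLog₀ ⟸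
`KimAtThreeFineKatoHLog.perFactorLog_of_dualInt : hDualTame → hDualWild → hLog₀` (w2-acc4 p511995). The two
displayed hypotheses end in
`∀ z, ∀ P ∈ E₀(K), ‖e_p⁻¹ (Tr_{L_w/ℚ_v} (exp*_ω(z) · ℓ(P)))‖ ≤ 1` with `ℓ(P) = Kw.toCompletion (Λ̃ P)` (tame,
`K = Kw p L w₀`) resp. `ℓ(P) = ι (Kw.toCompletion (Λ̃ P))` (wild, `K = Kw p F u`, `ι : F_u → L_{w₀}` the packet's tower
map), whereas the duality input DUALINT (w2-acc4's unit step `KimAtThreeFineKatoHLogDualUnit` applied to the cite fact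
(S5b-tower), w2-c3) delivers the same inequality for `ℓ = padicLogPointFiniteExt ν (W.baseChange L_{w₀}) p P′` over ALL
points `P′` of `W ⊗ L_{w₀}`. THIS FILE packages the E-side step from the point form to the lattice form, for an
ARBITRARY multiplier map `X : Z → L_w` in place of `exp*_ω` (the step does not look at it) and an arbitrary
`ℚ_p`-valued functional `T : L_w → ℚ_[p]` in place of `e_p⁻¹ ∘ Tr_{L_w/ℚ_v}` (idem):

* **`clause_e_tame_of_forall_point`** — `(∀ z P′, ‖T (X z * log_ω^{ν} P′)‖ ≤ 1) → ∀ z, ∀ P ∈ E₀(Kw p L w),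
  ‖T (X z * Kw.toCompletion (Λ̃ P))‖ ≤ 1` ((J4c) `Kw.exists_point_padicLogPointFiniteExt_eq_satLog`);
* **`clause_e_wild_of_forall_point`** — the same with `ι (Kw.toCompletion p F u (Λ̃ P))` for `P ∈ E₀(Kw p F u)`, `W` with
  `Addv W p` ((J4d) `Kw.exists_point_padicLogPointFiniteExt_eq_adicCompletionSemialgHom_satLog`);
* the `S`-forms `clause_e_tame_of_forall_mem_range` / `clause_e_wild_of_forall_mem_range` taking the hypothesis on the
  SET `{x | ∃ P′, log_ω^{ν} P′ = x}` (the `S` of w2-acc4's `forall_norm_apply_mul_le_one_of_range`).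

So `hDualTame` (resp. `hDualWild`) of `perFactorLog_of_dualInt` is `clause_e_tame_of_forall_point w₀ W ν X T hD`
(resp. `clause_e_wild_…`) with `X := expStarOmegaHom … dw hinjw hexw`, `T := e₃⁻¹ ∘ Algebra.trace ℚ_v L_{w₀}` and
`hD` = DUALINT at `(r, w₀)` for any compatible `ν` — smoke-tested at `L := CyclotomicField m ℚ` in the seat folder.
TOOL theorems only (no definition, no named fact, no `sorry`, no instance); closes nothing by itself; nothing
booked; BSD / 19560 are not proved by any of this.

References: J. H. Silverman, *The Arithmetic of Elliptic Curves*, 2nd ed. (2009), IV.6.4, VII.2 [SilvermanAEC2009];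
S. Bloch, K. Kato (1990) §3 Prop. 3.8, Ex. 3.11 [BlochKato1990] (the shape of DUALINT).
-/

noncomputable section

-- the cell's Theorems namespace `Summit.BirchSwinnertonDyer.BirchSwinnertonDyer.…` repeats the summit name by design (D-0017)
set_option linter.dupNamespace false

open scoped NNReal NumberField Classical
open IsDedekindDomain NumberField

namespace Summit.BirchSwinnertonDyer.BirchSwinnertonDyer.Theorems.KPort

open Summit.BirchSwinnertonDyer.Rank1Residual.Additive Summit.BirchSwinnertonDyer.Rank1Residual.Additive.BallEval
open Summit.BirchSwinnertonDyer.Rank1Residual.Additive.LocalLog Literature.NumberTheory.EllipticCurves.Rank1Residual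
open Literature.NumberTheory.GaloisRepresentations.LubinTate (unitBall mem_unitBall_iff)
open Literature.NumberTheory.EllipticCurves Literature.NumberTheory.EllipticCurves.FormalGroupChart
open Literature.NumberTheory.GaloisRepresentations Literature.NumberTheory.AdelicBaseChange
open WeierstrassCurve

namespace Kw

variable {p : ℕ} [hp : Fact p.Prime] {L : Type} [Field L] [NumberField L]
  (w : ((Rat.HeightOneSpectrum.primesEquiv (R := 𝓞 ℚ)).symm ⟨p, hp.out⟩).Extension (𝓞 L))

/-! ## §1 Tame: `Λ₀ʷ = {Kw.toCompletion (Λ̃ P) : P ∈ E₀(Kw p L w)}` -/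

section Tame

variable [he : Fact (w.1.asIdeal.ramificationIdx (𝓞 ℚ) = 1)] (W : WeierstrassCurve ℚ) [W.IsGloballyMinimal]
  [hE : (((integralModelInt W).map (Int.castRingHom ℤ_[p])).map PadicInt.Coe.ringHom).IsElliptic]
  [hint : (curveK p (Kw p L w) ((integralModelInt W).map (Int.castRingHom ℤ_[p]))).IsIntegral
    (NormedField.valuation (K := Kw p L w)).integer]
  (ν : Valuation (w.1.adicCompletion L) ℝ≥0) [ν.Compatible]
  [hν : (W.baseChange (w.1.adicCompletion L)).IsIntegral ν.integer]

/-- **Clause (e), tame lattice, from the point form**: if `‖T (X z · log_ω^{ν} P′)‖ ≤ 1` for every `z` and EVERY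
point `P′` of `W ⊗ L_w` (DUALINT), then `‖T (X z · Kw.toCompletion (Λ̃ P))‖ ≤ 1` for every `z` and every
`P ∈ E₀(Kw p L w)` — the conclusion of `hDualTame` with `X := exp*_ω`, `T := e₃⁻¹ ∘ Tr_{L_w/ℚ_v}`.
[cite: SilvermanAEC2009, Thm. IV.6.4 with Prop. VII.2.2] -/
theorem clause_e_tame_of_forall_point {Z : Type*} (X : Z → w.1.adicCompletion L) (T : w.1.adicCompletion L → ℚ_[p])
    (hD : ∀ (z : Z) (P' : (W.baseChange (w.1.adicCompletion L)).toAffine.Point),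
      ‖T (X z * padicLogPointFiniteExt ν (W.baseChange (w.1.adicCompletion L)) p P')‖ ≤ 1) :
    ∀ z : Z, ∀ P ∈ (((integralModelInt W).map (Int.castRingHom ℤ_[p])).map (coeffHom p (Kw p L w))).nonsingularReductionSubgroup
        (Valuation.integer.integers (NormedField.valuation (K := Kw p L w))),
      ‖T (X z * toCompletion p L w (satLog p (Kw p L w) ((integralModelInt W).map (Int.castRingHom ℤ_[p])) P))‖ ≤ 1 := by
  intro z P _hP
  obtain ⟨P', hP'⟩ := exists_point_padicLogPointFiniteExt_eq_satLog (p := p) w W ν P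
  rw [← hP']
  exact hD z P'

/-- **Clause (e), tame lattice, from the `S`-form**: the same with the hypothesis on the SET
`S = {x | ∃ P′, log_ω^{ν} P′ = x}` of logarithm values (`∀ z, ∀ ℓ ∈ S, ‖T (X z · ℓ)‖ ≤ 1`, the output of w2-acc4's
`forall_norm_apply_mul_le_one_of_range`). [cite: SilvermanAEC2009, Thm. IV.6.4 with Prop. VII.2.2] -/
theorem clause_e_tame_of_forall_mem_range {Z : Type*} (X : Z → w.1.adicCompletion L)
    (T : w.1.adicCompletion L → ℚ_[p])
    (hD : ∀ (z : Z), ∀ ℓ ∈ {x : w.1.adicCompletion L | ∃ P' : (W.baseChange (w.1.adicCompletion L)).toAffine.Point,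
        padicLogPointFiniteExt ν (W.baseChange (w.1.adicCompletion L)) p P' = x}, ‖T (X z * ℓ)‖ ≤ 1) :
    ∀ z : Z, ∀ P ∈ (((integralModelInt W).map (Int.castRingHom ℤ_[p])).map (coeffHom p (Kw p L w))).nonsingularReductionSubgroup
        (Valuation.integer.integers (NormedField.valuation (K := Kw p L w))),
      ‖T (X z * toCompletion p L w (satLog p (Kw p L w) ((integralModelInt W).map (Int.castRingHom ℤ_[p])) P))‖ ≤ 1 :=
  clause_e_tame_of_forall_point w W ν X T fun z P' => hD z _ ⟨P', rfl⟩

end Tame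

/-! ## §2 Wild: `ι(Λ₀ᵘ) = {ι (Kw.toCompletion p F u (Λ̃ P)) : P ∈ E₀(Kw p F u)}` along the tower `F_u → L_w` -/

section Wild

variable {F : Type} [Field F] [NumberField F] [Algebra F L]
  (u : ((Rat.HeightOneSpectrum.primesEquiv (R := 𝓞 ℚ)).symm ⟨p, hp.out⟩).Extension (𝓞 F))
  (h : w.1.under (𝓞 F) = u.1)
  [hu : Fact (u.1.asIdeal.ramificationIdx (𝓞 ℚ) = 1)] (W : WeierstrassCurve ℚ) [W.IsElliptic] [W.IsGloballyMinimal]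
  [hE : (((integralModelInt W).map (Int.castRingHom ℤ_[p])).map PadicInt.Coe.ringHom).IsElliptic]
  [hint : (curveK p (Kw p F u) ((integralModelInt W).map (Int.castRingHom ℤ_[p]))).IsIntegral
    (NormedField.valuation (K := Kw p F u)).integer]
  (ν : Valuation (w.1.adicCompletion L) ℝ≥0) [ν.Compatible]
  [hν : (W.baseChange (w.1.adicCompletion L)).IsIntegral ν.integer]

/-- **Clause (e), wild lattice, from the point form**: if `‖T (X z · log_ω^{ν} P′)‖ ≤ 1` for every `z` and EVERY
point `P′` of `W ⊗ L_w` (DUALINT at `w`), then `‖T (X z · ι (Kw.toCompletion p F u (Λ̃ P)))‖ ≤ 1` for every `z` and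
every `P ∈ E₀(Kw p F u)` (`W` additive at `p`), `ι = Extension.adicCompletionSemialgHom F L ⟨w.1, h⟩` — the conclusion
of `hDualWild` with `X := exp*_ω`, `T := e₃⁻¹ ∘ Tr_{L_w/ℚ_v}`. [cite: SilvermanAEC2009, Thm. IV.6.4 with Prop. VII.2.1–2.2] -/
theorem clause_e_wild_of_forall_point (hadd : Addv W p) {Z : Type*} (X : Z → w.1.adicCompletion L)
    (T : w.1.adicCompletion L → ℚ_[p])
    (hD : ∀ (z : Z) (P' : (W.baseChange (w.1.adicCompletion L)).toAffine.Point),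
      ‖T (X z * padicLogPointFiniteExt ν (W.baseChange (w.1.adicCompletion L)) p P')‖ ≤ 1) :
    ∀ z : Z, ∀ P ∈ (((integralModelInt W).map (Int.castRingHom ℤ_[p])).map (coeffHom p (Kw p F u))).nonsingularReductionSubgroup
        (Valuation.integer.integers (NormedField.valuation (K := Kw p F u))),
      ‖T (X z * HeightOneSpectrum.Extension.adicCompletionSemialgHom F L (⟨w.1, h⟩ : u.1.Extension (𝓞 L))
        (toCompletion p F u (satLog p (Kw p F u) ((integralModelInt W).map (Int.castRingHom ℤ_[p])) P)))‖ ≤ 1 := by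
  intro z P hP
  obtain ⟨P', hP'⟩ := exists_point_padicLogPointFiniteExt_eq_adicCompletionSemialgHom_satLog (p := p) w u h W ν
    (nonsingularReductionSubgroup_le_satKernel_of_addv W hadd hP)
  rw [← hP']
  exact hD z P'

/-- **Clause (e), wild lattice, from the `S`-form** (`S = {x | ∃ P′, log_ω^{ν} P′ = x}`).
[cite: SilvermanAEC2009, Thm. IV.6.4 with Prop. VII.2.1–2.2] -/
theorem clause_e_wild_of_forall_mem_range (hadd : Addv W p) {Z : Type*} (X : Z → w.1.adicCompletion L)
    (T : w.1.adicCompletion L → ℚ_[p])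
    (hD : ∀ (z : Z), ∀ ℓ ∈ {x : w.1.adicCompletion L | ∃ P' : (W.baseChange (w.1.adicCompletion L)).toAffine.Point,
        padicLogPointFiniteExt ν (W.baseChange (w.1.adicCompletion L)) p P' = x}, ‖T (X z * ℓ)‖ ≤ 1) :
    ∀ z : Z, ∀ P ∈ (((integralModelInt W).map (Int.castRingHom ℤ_[p])).map (coeffHom p (Kw p F u))).nonsingularReductionSubgroup
        (Valuation.integer.integers (NormedField.valuation (K := Kw p F u))),
      ‖T (X z * HeightOneSpectrum.Extension.adicCompletionSemialgHom F L (⟨w.1, h⟩ : u.1.Extension (𝓞 L))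
        (toCompletion p F u (satLog p (Kw p F u) ((integralModelInt W).map (Int.castRingHom ℤ_[p])) P)))‖ ≤ 1 :=
  clause_e_wild_of_forall_point w u h W ν hadd X T fun z P' => hD z _ ⟨P', rfl⟩

end Wild

/-! ## §3 Robustness: the duality input may carry ANY `ℚ`-algebra structure on `L_w` in its model `W ⊗ L_w`

(Appended 2026-08-27, w2-kport gen 3.) A DUALINT statement proved for a GENERIC factor field `L ⊇ ℚ_v`
(w2-acc4's `KimAtThreeFineKatoHLog.dualInt_of_towerFact`) specialises at `L := L_w` to a model
`@WeierstrassCurve.baseChange ℚ _ W L_w _ inst = W.map (algebraMap ℚ L_w)` whose `Algebra ℚ L_w` structure `inst`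
need not be the one synthesised in §1–§2 (e.g. `DivisionRing.toRatAlgebra` versus the completion's
`instAlgebraAdicCompletion`). Ring homomorphisms `ℚ → L_w` being unique, every model `W.map i` (`i : ℚ →+* L_w`)
EQUALS the canonical `W.baseChange L_w` (`map_eq_baseChange_of_ringHom_rat`) and the point forms transfer
(`exists_point_padicLogPointFiniteExt_eq_of_eq`); the primed reductions below accept the hypothesis for the model
`W.map i` with an arbitrary `i` — a consumer's `@baseChange ℚ _ W L_w _ inst` unifies with `W.map i` by unfolding —
and its integrality witness `hν'`. -/

section AnyRatAlgebra

omit hp in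
/-- Every model `W.map i` along a ring homomorphism `i : ℚ → F` is the base change `W ⊗ F` (ring homomorphisms
out of `ℚ` are unique). [folklore] -/
theorem map_eq_baseChange_of_ringHom_rat {F : Type*} [CommRing F] [Algebra ℚ F] (i : ℚ →+* F)
    (W : WeierstrassCurve ℚ) : W.map i = W.baseChange F := by
  unfold WeierstrassCurve.baseChange
  congr 1
  exact Subsingleton.elim _ _

variable (W : WeierstrassCurve ℚ) [W.IsGloballyMinimal] (ν : Valuation (w.1.adicCompletion L) ℝ≥0)
  [hν : (W.baseChange (w.1.adicCompletion L)).IsIntegral ν.integer]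

omit [W.IsGloballyMinimal] in
/-- **Point form for a model `W.map i` ⇒ point form for the canonical model `W ⊗ L_w`** (same logarithm values).
[cite: SilvermanAEC2009, Thm. IV.6.4 with Prop. VII.2.2] -/
theorem forall_point_of_forall_point_map (i : ℚ →+* w.1.adicCompletion L)
    (hν' : (W.map i).IsIntegral ν.integer)
    {Z : Type*} (X : Z → w.1.adicCompletion L) (T : w.1.adicCompletion L → ℚ_[p])
    (hD : ∀ (z : Z) (P' : (W.map i).toAffine.Point), ‖T (X z * padicLogPointFiniteExt ν (W.map i) p P')‖ ≤ 1) :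
    ∀ (z : Z) (P' : (W.baseChange (w.1.adicCompletion L)).toAffine.Point),
      ‖T (X z * padicLogPointFiniteExt ν (W.baseChange (w.1.adicCompletion L)) p P')‖ ≤ 1 := by
  intro z P'
  haveI := hν'
  have hC : W.baseChange (w.1.adicCompletion L) = W.map i := (map_eq_baseChange_of_ringHom_rat i W).symm
  obtain ⟨P'', hP''⟩ := exists_point_padicLogPointFiniteExt_eq_of_eq ν hC p P'
  rw [← hP'']
  exact hD z P''

variable [ν.Compatible] [he : Fact (w.1.asIdeal.ramificationIdx (𝓞 ℚ) = 1)]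
  [hE : (((integralModelInt W).map (Int.castRingHom ℤ_[p])).map PadicInt.Coe.ringHom).IsElliptic]

/-- **Clause (e), tame lattice, from a point form on ANY model `W.map i`** (`i : ℚ →+* L_w`; a consumer's
`@WeierstrassCurve.baseChange ℚ _ W L_w _ inst` is such a model by unfolding). [cite: SilvermanAEC2009, Thm. IV.6.4 with Prop. VII.2.2] -/
theorem clause_e_tame_of_forall_point'
    [hint : (curveK p (Kw p L w) ((integralModelInt W).map (Int.castRingHom ℤ_[p]))).IsIntegral
      (NormedField.valuation (K := Kw p L w)).integer]
    (i : ℚ →+* w.1.adicCompletion L) (hν' : (W.map i).IsIntegral ν.integer)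
    {Z : Type*} (X : Z → w.1.adicCompletion L) (T : w.1.adicCompletion L → ℚ_[p])
    (hD : ∀ (z : Z) (P' : (W.map i).toAffine.Point), ‖T (X z * padicLogPointFiniteExt ν (W.map i) p P')‖ ≤ 1) :
    ∀ z : Z, ∀ P ∈ (((integralModelInt W).map (Int.castRingHom ℤ_[p])).map (coeffHom p (Kw p L w))).nonsingularReductionSubgroup
        (Valuation.integer.integers (NormedField.valuation (K := Kw p L w))),
      ‖T (X z * toCompletion p L w (satLog p (Kw p L w) ((integralModelInt W).map (Int.castRingHom ℤ_[p])) P))‖ ≤ 1 :=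
  clause_e_tame_of_forall_point w W ν X T (forall_point_of_forall_point_map w W ν i hν' X T hD)

omit he in
/-- **Clause (e), wild lattice, from a point form on ANY model `W.map i`** (`i : ℚ →+* L_w`).
[cite: SilvermanAEC2009, Thm. IV.6.4 with Prop. VII.2.1–2.2] -/
theorem clause_e_wild_of_forall_point' [W.IsElliptic] {F : Type} [Field F] [NumberField F] [Algebra F L]
    (u : ((Rat.HeightOneSpectrum.primesEquiv (R := 𝓞 ℚ)).symm ⟨p, hp.out⟩).Extension (𝓞 F))
    (h : w.1.under (𝓞 F) = u.1) [hu : Fact (u.1.asIdeal.ramificationIdx (𝓞 ℚ) = 1)]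
    [hintF : (curveK p (Kw p F u) ((integralModelInt W).map (Int.castRingHom ℤ_[p]))).IsIntegral
      (NormedField.valuation (K := Kw p F u)).integer]
    (hadd : Addv W p) (i : ℚ →+* w.1.adicCompletion L) (hν' : (W.map i).IsIntegral ν.integer)
    {Z : Type*} (X : Z → w.1.adicCompletion L) (T : w.1.adicCompletion L → ℚ_[p])
    (hD : ∀ (z : Z) (P' : (W.map i).toAffine.Point), ‖T (X z * padicLogPointFiniteExt ν (W.map i) p P')‖ ≤ 1) :
    ∀ z : Z, ∀ P ∈ (((integralModelInt W).map (Int.castRingHom ℤ_[p])).map (coeffHom p (Kw p F u))).nonsingularReductionSubgroup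
        (Valuation.integer.integers (NormedField.valuation (K := Kw p F u))),
      ‖T (X z * HeightOneSpectrum.Extension.adicCompletionSemialgHom F L (⟨w.1, h⟩ : u.1.Extension (𝓞 L))
        (toCompletion p F u (satLog p (Kw p F u) ((integralModelInt W).map (Int.castRingHom ℤ_[p])) P)))‖ ≤ 1 :=
  clause_e_wild_of_forall_point w u h W ν hadd X T (forall_point_of_forall_point_map w W ν i hν' X T hD)

end AnyRatAlgebra

end Kw

end Summit.BirchSwinnertonDyer.BirchSwinnertonDyer.Theorems.KPort

end
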